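import Summits.AnomalousDissipation.AnomalousDissipation.Theorems.SolenoidalFractalHomogenisationLagrangianStepOneLevelDefs
import Summits.AnomalousDissipation.AnomalousDissipation.Theorems.IsotropicCubatureWord
import Mathlib.Analysis.Normed.Algebra.MatrixExponential
import Mathlib.Analysis.InnerProductSpace.Adjoint

/-!
# K1L `LagrangianRenormalisationStep` (stmt-AnomalousDissipation-24912) — crux idea `chang-slow-graph`
(planner ad-ideate-p5 gen 4, lens «profile» = profile-and-certify), SKETCH of the typed statements.  Nothing here is proved; every item
elaborates.  Vocabulary: the LANDED shared definitions of the K1L skeleton of record (`…Theorems.SolenoidalFractalHomogenisation.LagrangianStep`: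
`slotWeight, mhat, excShape, cellField, modeCoeff, WindowClause, SlowVectorClause, CellEnergyClauses`, p610007 + OneLevelDefs), the cubature word
`Theorems.cubatureWord`, and `Literature.Analysis.FluidPDE.PassiveVectorTensor` (`Torus.Visc4 / symb / NearIso / OddSmall`).  `transversePairs`,
`qsResp`, `excQS` are VERBATIM copies of the sibling sketch `LoewnerWindowSketch.lean` (crux idea `loewner-reflected-window`, same seat; that module is
not importable from here), so that the two cards speak about the same objects.

THE LEVER (clause (V) = `SlowVectorClause`, the Floquet–Bloch heart of `stub_cellLawV`, and (F)+(C) = `CellEnergyClauses` = `stub_cellEnergyT`).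
At Bloch momentum `ξ = ℓ/n` the cell system (cell coordinates, Galerkin level `N`, energy norm) is a linear block system
`ẋ = A₁₁x + A₁₂z`, `ż = A₂₁x + A₂₂z` with `x` = the two transverse polarisations at cell harmonic `k = 0` (wave vector `ξ`) and `z` = all
`k ≠ 0`.  Three exact structural facts: the fast block is UNIFORMLY DISSIPATIVE, `⟪A₂₂z,z⟫ ≤ −γ‖z‖²`, `γ = 4π²ν·(lo/Λ)·(1−|ξ|)²`
(Legendre–Hadamard lower window `NearIso` + skewness of advection and of the Leray-compressed advection; the odd part of the tensor does not
enter the quadratic form); the couplings are SMALL, `‖A₁₂‖, ‖A₂₁‖ ≤ δ = |ξ|/√2` (one layer active at a time, `|e·ξ|/(2|m|)` per sideband);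
the slow block is SLOWER still, `‖A₁₁‖ ≤ s₀ = 4π²ν·hiΛ·|ξ|²`.  Hence CHANG'S DECOUPLING TRANSFORMATION (K. W. Chang 1972; Kokotović–Bensoussan–
Blankenship 1987 §2 eq. (2.29), Thm 2.3, §3 eq. (3.3)–(3.7)) exists with EXPLICIT, DIMENSION-FREE bounds: the Riccati graph `z = Lx`,
`L̇ = A₂₁ + A₂₂L − LA₁₁ − LA₁₂L`, stays in the ball `‖L‖ ≤ 2δ/(γ−s₀) = O(|ξ|/ν)` (G1), reduces the slow sector EXACTLY to
`ẋ = (A₁₁ + A₁₂L)x` (G2), and `L = L₁ + O((δ/γ)³)` with `L₁` the Duhamel (second-order) graph (G3).  The period average of the reduced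
generator, normalised, is then a CHAIN SUM with closed forms: single slot = `qsResp` EXACTLY (the `excQS` slot term), ADJACENT EQUAL-DIRECTION
slot pair = the factorised memory term `pairQS` below (the cubature word plays the two polarisations of each of its 13 directions in adjacent
slots, phases 0), every other chain carries at least one full foreign-slot decay `e^{−4π²(lo/Λ)|m|²Mτ} ≤ e^{−1289·M}` AND an excursion through a
mixing layer, so it vanishes as `ν → 0`.  Consequences typed below: the explicit limit shape map `Φ = N⁻¹(excQS + pairQS)` in (V) with
`σ = 2` (P4); the relative size of the memory term `≤ 1.22·10⁻⁸/M³` of `excQS` on transverse pairs for window shapes (P3) — which is the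
hypothesis of the sibling card's `QSWindowPerturbed` (S3′) with two orders of room against its margin `3.1·10⁻⁷/M²`; and (C)/(F) as the two
off-diagonal blocks `‖Lx‖² ≤ (2δ/(γ−s₀))²‖x‖²`, `‖Hz‖² ≤ …` of the same transformation.

THE PROFILE (folder `k1l4/pair_memory.py`, pure python, 20 s; log `pair_memory.log`): (A) closed forms `ϑ(½,T)`, `J(½,T) = ∫₀¹a(u)e^{−Tu}du`,
ratio `R(T) = T·J²/ϑ = 12/T³·(1 + O(1/T))` (`R = 3.047·10⁻⁹` at `T₁ = 4π²·40 = 1579`); (B) the factorised pair formula against the exact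
second-order functional of the two-slot ODE (agreement `2·10⁻⁸ … 1·10⁻⁶`, = quadrature error); (C) the full two-amplitude system at finite
coupling: `−ln A − (2nd order) = 0.60·(g/λ)²·(2nd order)` for `g/λ = 0.1 … 0.0125` (the graph correction is QUADRATIC in coupling/gap, i.e.
`σ = 2` in `|ξ|/ν`), leftover sideband `= g·J` exactly; (D) `η(M) = ½·max_b R(T₁b)`, `b ∈ [lo/Λ, hiΛ]`: `2.8·10⁻⁹/M³` at aspect 3/2
(`3.2·10⁻⁹/M³` with `Λ = 1.05`; `1.22·10⁻⁸/M³` for the wide window `[½, 2]`) against the S3′ allowance `3.1·10⁻⁷/M²` — room `112·M ×`.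
-/

set_option linter.dupNamespace false

namespace Summit.AnomalousDissipation.AnomalousDissipation.Cruxes.LagrangianRenormalisationStep.SlowGraph

open Literature.Analysis Literature.Analysis.FluidPDE Literature.Analysis.FunctionSpaces
open Summit.AnomalousDissipation.AnomalousDissipation.Theorems.SolenoidalFractalHomogenisation.LagrangianStep
open MeasureTheory Set
open scoped InnerProductSpace

noncomputable section

/-! ## G — the abstract lever: Chang's Riccati decoupling of a slow–fast linear system in a dissipative energy norm
(finite-dimensional real inner-product spaces `E` (slow) and `F` (fast); the Galerkin cell system at one Bloch momentum is the instance,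
with constants independent of the truncation) -/

/-- (G1, the INVARIANT BALL; M) If the fast block is `γ`-dissipative, the slow block has norm `≤ s₀ < γ`, the couplings have norm `≤ δ` with
`8δ² ≤ (γ−s₀)²`, then a solution of Chang's Riccati equation `L̇ = A₂₁ + A₂₂L − LA₁₁ − LA₁₂L` starting in the ball of radius
`r = 2δ/(γ−s₀)` stays in it (on the sphere `‖L‖ = r` the operator-norm Dini derivative is `≤ −(γ−s₀)r + δ + δr² < 0`).
Source: Kokotović–Bensoussan–Blankenship 1987, §2 eq. (2.29) and Thm 2.3 (Chang 1969/1972), with the Hurwitz hypothesis (2.23) replaced by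
energy dissipativity (which is what makes the constants dimension-free). -/
def RiccatiInvariantBall : Prop :=
  ∀ (E F : Type) [NormedAddCommGroup E] [InnerProductSpace ℝ E] [FiniteDimensional ℝ E]
    [NormedAddCommGroup F] [InnerProductSpace ℝ F] [FiniteDimensional ℝ F]
    (A₁₁ : ℝ → E →L[ℝ] E) (A₁₂ : ℝ → F →L[ℝ] E) (A₂₁ : ℝ → E →L[ℝ] F) (A₂₂ : ℝ → F →L[ℝ] F)
    (L : ℝ → E →L[ℝ] F) (γ δ s₀ T : ℝ),
    0 < γ → 0 ≤ δ → 0 ≤ s₀ → s₀ < γ → 8 * δ ^ 2 ≤ (γ - s₀) ^ 2 → 0 ≤ T →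
    (∀ t ∈ Icc 0 T, ∀ z : F, ⟪A₂₂ t z, z⟫_ℝ ≤ -γ * ‖z‖ ^ 2) →
    (∀ t ∈ Icc 0 T, ‖A₁₁ t‖ ≤ s₀) → (∀ t ∈ Icc 0 T, ‖A₁₂ t‖ ≤ δ) → (∀ t ∈ Icc 0 T, ‖A₂₁ t‖ ≤ δ) →
    (∀ t ∈ Ico 0 T, HasDerivAt L (A₂₁ t + (A₂₂ t).comp (L t) - (L t).comp (A₁₁ t) - ((L t).comp (A₁₂ t)).comp (L t)) t) →
    ContinuousOn L (Icc 0 T) →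
    ‖L 0‖ ≤ 2 * δ / (γ - s₀) → ∀ t ∈ Icc 0 T, ‖L t‖ ≤ 2 * δ / (γ - s₀)

/-- (G2, EXACT REDUCTION; S) Along a solution of the Riccati equation the graph `z = Lx` is invariant and carries the reduced slow dynamics
`ẋ = (A₁₁ + A₁₂L)x`: if `(x, z)` solves the block system with `z 0 = L 0 (x 0)` then `z t = L t (x t)` throughout (the defect `z − Lx` solves the
homogeneous linear equation `η̇ = (A₂₂ − LA₁₂)η` from `0`).  Kokotović–Bensoussan–Blankenship 1987 §3 eq. (3.5)–(3.7). -/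
def GraphReduction : Prop :=
  ∀ (E F : Type) [NormedAddCommGroup E] [InnerProductSpace ℝ E] [FiniteDimensional ℝ E]
    [NormedAddCommGroup F] [InnerProductSpace ℝ F] [FiniteDimensional ℝ F]
    (A₁₁ : ℝ → E →L[ℝ] E) (A₁₂ : ℝ → F →L[ℝ] E) (A₂₁ : ℝ → E →L[ℝ] F) (A₂₂ : ℝ → F →L[ℝ] F)
    (L : ℝ → E →L[ℝ] F) (x : ℝ → E) (z : ℝ → F) (T B : ℝ), 0 ≤ T →
    (∀ t ∈ Icc 0 T, ‖A₂₂ t‖ ≤ B ∧ ‖A₁₂ t‖ ≤ B ∧ ‖L t‖ ≤ B) →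
    (∀ t ∈ Ico 0 T, HasDerivAt L (A₂₁ t + (A₂₂ t).comp (L t) - (L t).comp (A₁₁ t) - ((L t).comp (A₁₂ t)).comp (L t)) t) →
    (∀ t ∈ Ico 0 T, HasDerivAt x (A₁₁ t (x t) + A₁₂ t (z t)) t) →
    (∀ t ∈ Ico 0 T, HasDerivAt z (A₂₁ t (x t) + A₂₂ t (z t)) t) →
    ContinuousOn L (Icc 0 T) → ContinuousOn x (Icc 0 T) → ContinuousOn z (Icc 0 T) →
    z 0 = L 0 (x 0) →
    (∀ t ∈ Icc 0 T, z t = L t (x t)) ∧ ∀ t ∈ Ico 0 T, HasDerivAt x ((A₁₁ t + (A₁₂ t).comp (L t)) (x t)) t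

/-- (G3, the DUHAMEL REMAINDER; M) Under the hypotheses of G1 the graph is its second-order (Duhamel) part up to a relatively QUADRATIC error in
coupling/gap: if `L₁̇ = A₂₁ + A₂₂L₁`, `L₁ 0 = L 0`, then `‖L t − L₁ t‖ ≤ r(s₀ + δr)/γ`, `r = 2δ/(γ−s₀)` (the defect solves
`ρ̇ = A₂₂ρ − LA₁₁ − LA₁₂L`, forcing of norm `≤ rs₀ + r²δ`, and `ξ ↦ ρξ` is `γ`-damped for each fixed `ξ`).  Hence the reduced generator is
`A₁₁ + A₁₂L₁ + O(δ·r·(s₀+δr)/γ)`: relative to the leading excess `A₁₂L₁ = O(δ²/γ)` the error is `O((δ/γ)² + s₀/γ) = O((|ξ|/ν)²) + O(|ξ|²)` —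
the source of `σ = 2` in (V) (profile PART C: measured `0.60·(g/λ)²`). -/
def DuhamelRemainder : Prop :=
  ∀ (E F : Type) [NormedAddCommGroup E] [InnerProductSpace ℝ E] [FiniteDimensional ℝ E]
    [NormedAddCommGroup F] [InnerProductSpace ℝ F] [FiniteDimensional ℝ F]
    (A₁₁ : ℝ → E →L[ℝ] E) (A₁₂ : ℝ → F →L[ℝ] E) (A₂₁ : ℝ → E →L[ℝ] F) (A₂₂ : ℝ → F →L[ℝ] F)
    (L L₁ : ℝ → E →L[ℝ] F) (γ δ s₀ T : ℝ),
    0 < γ → 0 ≤ δ → 0 ≤ s₀ → s₀ < γ → 8 * δ ^ 2 ≤ (γ - s₀) ^ 2 → 0 ≤ T →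
    (∀ t ∈ Icc 0 T, ∀ z : F, ⟪A₂₂ t z, z⟫_ℝ ≤ -γ * ‖z‖ ^ 2) →
    (∀ t ∈ Icc 0 T, ‖A₁₁ t‖ ≤ s₀) → (∀ t ∈ Icc 0 T, ‖A₁₂ t‖ ≤ δ) → (∀ t ∈ Icc 0 T, ‖A₂₁ t‖ ≤ δ) →
    (∀ t ∈ Ico 0 T, HasDerivAt L (A₂₁ t + (A₂₂ t).comp (L t) - (L t).comp (A₁₁ t) - ((L t).comp (A₁₂ t)).comp (L t)) t) →
    (∀ t ∈ Ico 0 T, HasDerivAt L₁ (A₂₁ t + (A₂₂ t).comp (L₁ t)) t) →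
    ContinuousOn L (Icc 0 T) → ContinuousOn L₁ (Icc 0 T) → L₁ 0 = L 0 →
    ‖L 0‖ ≤ 2 * δ / (γ - s₀) →
    ∀ t ∈ Icc 0 T, ‖L t - L₁ t‖ ≤ (2 * δ / (γ - s₀)) * (s₀ + δ * (2 * δ / (γ - s₀))) / γ

/-! ## The chain sum: `qsResp` / `excQS` (verbatim from `LoewnerWindowSketch`), the ramp transform `Jmat` and the pair memory term `pairQS` -/

/-- Unit transverse pairs `(q, p)`: `|q| = |p| = 1`, `p ⊥ q` (verbatim copy, `LoewnerWindow.transversePairs`). -/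
def transversePairs : Set ((Fin 3 → ℝ) × (Fin 3 → ℝ)) :=
  {qp | (∑ a, qp.1 a ^ 2) = 1 ∧ (∑ i, qp.2 i ^ 2) = 1 ∧ (∑ i, qp.2 i * qp.1 i) = 0}

/-- The quasi-static SLOT RESPONSE OPERATOR `f_T(B) = T ∫₀¹ a(s) ∫₀ˢ a(x) e^{−T(s−x)B} dx ds` (verbatim copy, `LoewnerWindow.qsResp`):
the EXACT second-order response functional of one slot started with empty sidebands. -/
def qsResp (ρ T : ℝ) (B : Matrix (Fin 3) (Fin 3) ℝ) : Matrix (Fin 3) (Fin 3) ℝ := fun i j =>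
  T * ∫ s in (0:ℝ)..1, LatticeShear.LatticeWord.trapezoid 0 1 ρ s *
    ∫ x in (0:ℝ)..s, LatticeShear.LatticeWord.trapezoid 0 1 ρ x * (NormedSpace.exp (-(T * (s - x)) • B)) i j

/-- The QUASI-STATIC EXCESS tensor of the word `W` pre-stretched by `M` at background shape `S` (verbatim copy, `LoewnerWindow.excQS`). -/
def excQS {k : ℕ} (W : LatticeShear.LatticeWord k) (M : ℝ) (S : Torus.Visc4 (Fin 3)) : Torus.Visc4 (Fin 3) := fun i a j b =>
  ∑ s, (let P := W.phase s
    let mn : ℝ := ‖Torus.latticeVec P.m‖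
    let Sig : Matrix (Fin 3) (Fin 3) ℝ := fun i' j' => ∑ a', ∑ b', S i' a' j' b' * mhat P a' * mhat P b'
    let Pm : Matrix (Fin 3) (Fin 3) ℝ := fun i' j' => (if i' = j' then 1 else 0) - mhat P i' * mhat P j'
    let Q : Matrix (Fin 3) (Fin 3) ℝ := qsResp W.ramp (4 * Real.pi ^ 2 * mn ^ 2 * M * P.τ) (Pm * Sig * Pm + Matrix.vecMulVec (mhat P) (mhat P)) * Pm
    P.τ / (2 * (2 * Real.pi * mn) ^ 4) / W.period * (P.e a * P.e b) * Q i j)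

/-- The RAMP TRANSFORM `J_X(B) = ∫₀¹ a(u) e^{−XuB} du` of the unit slot envelope, as a matrix function: the sideband LEFT OVER at the end of a slot
of non-dimensional relaxation `X` is `g·J_X(B)` times the slow amplitude (symmetric envelope: start and end transforms coincide), and the memory
response of an adjacent equal-direction slot pair FACTORISES as `J_{T_s}(B)·J_{T_{s'}}(B)` (the exponential `e^{−λB(t + L_s − t′)}` splits).
Scalar asymptotics `J_X(1) = 1/(ρX²) + O(e^{−ρX})` (ramp `ρ`; profile PART A). -/
def Jmat (ρ X : ℝ) (B : Matrix (Fin 3) (Fin 3) ℝ) : Matrix (Fin 3) (Fin 3) ℝ := fun i j =>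
  ∫ u in (0:ℝ)..1, LatticeShear.LatticeWord.trapezoid 0 1 ρ u * (NormedSpace.exp (-(X * u) • B)) i j

open Classical in
/-- Phase/orientation factor of an ordered slot pair with a common lattice LINE: `cos(φ − φ′)` if `m′ = m`, `−cos(φ + φ′)` if `m′ = −m`, else `0`
(the `±m` sideband paths are complex conjugate; only a layer on the same line returns a leftover sideband to the slow mode at second order). -/
def pairSign (P P' : LatticeShear.LatticePhase) : ℝ :=
  if P'.m = P.m then Real.cos (P.φ - P'.φ) else if P'.m = -P.m then -Real.cos (P.φ + P'.φ) else 0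

/-- The PAIR MEMORY tensor of the word `W` pre-stretched by `M` at background shape `S`, in the units of `excQS`: the second-order contribution of
the sideband left over by slot `s` and returned to the slow mode by the NEXT slot `s′ = s+1 (mod k)` when it lies on the same lattice line —
`Σ_s 1[m_{s+1} = ±m_s]·pairSign·M τ_s τ_{s′}/(8π²|m_s|²·period)·(e_s)_a (e_{s′})_b·(J_{T_s}(B̂_s) J_{T_{s′}}(B̂_s) P_s)_{ij}`,
`T_s = 4π²|m_s|²Mτ_s`, `B̂_s` the regularised transverse block as in `excQS`.  Normalisation check: against the `excQS` slot term
`τ_s/(2(2π|m_s|)⁴·period)·(e_s)_a(e_s)_b·(f_{T_s}(B̂_s)P_s)_{ij}` the ratio of scalar weights is `T_{s′}·J_{T_s}J_{T_{s′}}/f_{T_s} = R(T)`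
(`= 12/T³` to leading order at ramp ½, equal `τ`). -/
def pairQS {k : ℕ} (W : LatticeShear.LatticeWord k) (M : ℝ) (S : Torus.Visc4 (Fin 3)) : Torus.Visc4 (Fin 3) := fun i a j b =>
  ∑ s, ∑ s', (if (s.val + 1) % k = s'.val then (1:ℝ) else 0) * (let P := W.phase s
    let P' := W.phase s'
    let mn : ℝ := ‖Torus.latticeVec P.m‖
    let Sig : Matrix (Fin 3) (Fin 3) ℝ := fun i' j' => ∑ a', ∑ b', S i' a' j' b' * mhat P a' * mhat P b'
    let Pm : Matrix (Fin 3) (Fin 3) ℝ := fun i' j' => (if i' = j' then 1 else 0) - mhat P i' * mhat P j'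
    let Breg : Matrix (Fin 3) (Fin 3) ℝ := Pm * Sig * Pm + Matrix.vecMulVec (mhat P) (mhat P)
    let Q : Matrix (Fin 3) (Fin 3) ℝ :=
      Jmat W.ramp (4 * Real.pi ^ 2 * mn ^ 2 * M * P.τ) Breg * Jmat W.ramp (4 * Real.pi ^ 2 * mn ^ 2 * M * P'.τ) Breg * Pm
    pairSign P P' * M * P.τ * P'.τ / (8 * Real.pi ^ 2 * mn ^ 2) / W.period * (P.e a * P'.e b) * Q i j)

/-! ## Statements (crux idea `chang-slow-graph`; none proved here) -/

/-- (P1, calculus; S) The ramp transform is bounded by the initial ramp alone: `a(u) ≤ u/ρ` gives `J_X(1) ≤ ∫₀^∞ (u/ρ)e^{−Xu}du = 1/(ρX²)`.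
With the tree's `|ϑ(ρ,T) − (1 − 4ρ/3)| ≤ 4/T²` (`LatticeShear.abs_slotWeight_sub_le`) this bounds the pair/single ratio
`R(T,b) = T b J_{Tb}(1)²/ϑ(ρ,Tb) ≤ (1/(ρ²(1−4ρ/3)))·(Tb)⁻³·(1 − 4/((1−4ρ/3)T²b²))⁻¹` (`= 12.0002/(Tb)³` at `ρ = ½`, `Tb ≥ 790`). -/
def RampLaplaceBound : Prop :=
  ∀ ρ X : ℝ, 0 < ρ → ρ ≤ 1 / 2 → 0 < X →
    ∫ u in (0:ℝ)..1, LatticeShear.LatticeWord.trapezoid 0 1 ρ u * Real.exp (-(X * u)) ≤ 1 / (ρ * X ^ 2)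

/-- (P2, the FACTORISATION; S) The cross-slot second-order kernel of two consecutive slots on one lattice line factorises into the end transform of
the first slot times the start transform of the second (scalar form; the matrix form is the same identity for the commuting family `e^{−tB}`):
`∫₀^{L′}∫₀^{L} a′(t)a(t′)e^{−λ(t+L−t′)}dt′dt = (∫₀^{L′}a′(t)e^{−λt}dt)(∫₀^{L}a(t′)e^{−λ(L−t′)}dt′)` (profile PART B: ODE vs formula, `2·10⁻⁸…10⁻⁶`). -/
def PairFactorisation : Prop :=
  ∀ (lam Ls Ls' : ℝ) (a a' : ℝ → ℝ), 0 < Ls → 0 < Ls' →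
    IntervalIntegrable a volume 0 Ls → IntervalIntegrable a' volume 0 Ls' →
    ∫ t in (0:ℝ)..Ls', ∫ t' in (0:ℝ)..Ls, a' t * a t' * Real.exp (-(lam * (t + (Ls - t')))) =
      (∫ t in (0:ℝ)..Ls', a' t * Real.exp (-(lam * t))) * (∫ t' in (0:ℝ)..Ls, a t' * Real.exp (-(lam * (Ls - t'))))

/-- (P3, the MEMORY BOUND for the cubature word; M given P1) For every pre-stretch `M ≥ 1` and every background shape with symmetric transverse
blocks in the wide window `[½, 2]`, the pair memory tensor is RELATIVELY small against the quasi-static excess on unit transverse pairs: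
`|symb(pairQS)(q,p)| ≤ 3·10⁻⁸/M³ · symb(excQS)(q,p)` — per direction, `|2(e·q)(e′·q)| ≤ (e·q)² + (e′·q)²` and `J_T(B̂)² ≤ R_max·f_T(B̂)/T`
eigenvalue-wise on the commuting family, `R_max = ½·max_{b∈[½,2]} R(T₁ b) = 1.22·10⁻⁸/M³` (`T₁ = 4π²·40·M`; classes 2, 3 are `10⁻¹¹`, `10⁻¹³`);
profile PART D.  This is the hypothesis `η` of the sibling card's `QSWindowPerturbed` (S3′), which allows `η ≤ 3.1·10⁻⁷/M²` at aspect 3/2. -/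
def CubaturePairMemoryBound : Prop :=
  ∀ M : ℝ, 1 ≤ M → ∀ S : Torus.Visc4 (Fin 3), Torus.OddSmall S 0 → Torus.NearIso S (1 / 2) 2 →
    ∀ qp ∈ transversePairs,
      |Torus.symb (pairQS Theorems.cubatureWord M S) qp.1 qp.2| ≤
        3 / (10 ^ 8 * M ^ 3) * Torus.symb (excQS Theorems.cubatureWord M S) qp.1 qp.2

/-- (P4, clause (V) WITH THE EXPLICIT LIMIT MAP; XL given G1–G3, P2 and the foreign-slot decorrelation K3 of the card) For the cubature word, every
pre-stretch `M ≥ 1` and every window `(lo, hi, Λ)`, the slow-vector clause of the K1L package holds with the EXPLICIT shape map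
`Φ = N⁻¹(excQS + pairQS)` (gain constant `c = N`), odd bound `β = 0` and error exponent `σ = 2`: the normalised period-averaged reduced generator
of the Bloch-fibred cell system converges to `Φ` as `(ν, |ξ|/ν) → 0`, with all deviations `O((|ξ|/ν)²)` (graph remainder G3 + in-period time
ordering), `O(|ξ|²)` (sideband tilts, the `O(|ξ|)` parts cancelling between the `±m` sidebands) or superpolynomially small in `ν` (chains through a
mixing foreign layer; prefactor `≤ e^{−1.1·10⁵·M}`), and the in-period transient covered by the clause's burst term `r̄P`. -/
def CubatureExactMapSlowVector : Prop :=
  ∀ M : ℝ, ∀ hM : 0 < M, 1 ≤ M → ∀ lo hi Λ : ℝ, 0 < lo → lo ≤ 1 → 1 ≤ hi → 1 ≤ Λ →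
    ∃ N > (0:ℝ), ∃ C > (0:ℝ), ∃ ν₀ > (0:ℝ), ∃ K > (0:ℝ),
      SlowVectorClause Theorems.cubatureWord M hM N
        (fun S => N⁻¹ • (excQS Theorems.cubatureWord M S + pairQS Theorems.cubatureWord M S)) lo hi Λ 0 2 C ν₀ K

/-- (P5, clauses (F)+(C) FROM THE SAME TRANSFORMATION; L given G1 and its complement `H`) For the cubature word the cell-energy clauses hold for
every `M > 0`, `c > 0` and window, with `β = 0`: (C) is `‖Lx‖² ≤ (2δ/(γ−s₀))²‖x‖²`, `δ/γ = O(|ℓ|/(nν))`, and (F) is the same bound for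
Chang's complementary operator `H` (fast data have slow content only through `H`, `‖H‖ ≤ 2δ_L/(γ−s₀)`, `δ_L = O(L/n)` over the Bloch momenta
below `L`).  Stated here = `stub_cellEnergyT` specialised to the cubature word and `β = 0` (the target of G1, not a new claim). -/
def CubatureCellEnergyFromGraph : Prop :=
  ∀ M : ℝ, ∀ hM : 0 < M, ∀ c : ℝ, 0 < c → ∀ lo hi Λ : ℝ, 0 < lo → lo ≤ hi → 1 ≤ Λ →
    ∃ C > (0:ℝ), ∃ ν₀ > (0:ℝ), ∃ K > (0:ℝ), CellEnergyClauses Theorems.cubatureWord M hM c lo hi Λ 0 C ν₀ K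

end

end Summit.AnomalousDissipation.AnomalousDissipation.Cruxes.LagrangianRenormalisationStep.SlowGraph
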